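import Summits.QuantumFields.YangMills.Theorems.BalabanUVNodesN19CutTransferAtSpineReading
import Summits.QuantumFields.YangMills.Theorems.BalabanUVNodesN19CoreEdgeFSCComposer
import Summits.QuantumFields.YangMills.Theorems.BalabanUVNodesN20ZeroDialFacesAtRecord13CoPHV

/-!
# BalabanUVNodes ∕ N20 (NE7b) — THE CUT DIAL OF K3⁷ STUB 2 IS ELIMINABLE AT THE v5 TEXTS: the stub-2 body «∃ jc sh cr, PinnedAtLive jc sh cr ∧ KeyedRelWeight cr ∧
# KeyedShellWeight cr ∧ KeyedExtraction cr ∧ KeyedCoreEdgeHolderD4 β cr rr» is EQUIVALENT to its ZERO-CUT specialisation «∃ sh cr, PinnedAtLive 0 sh cr ∧ …» — a BUDGET-FREE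
# fold (no `W + Wsh < 1`) under the `ForSmallCouplings` prefix, generic in `N`, in the guard, in the live predicate and in the rates premise

Cell `pub-ymgap` (HUMAN RULING D-0062 Track A; work-bound push D-0149, director-ym №197), width seat `pub-ymgap-dag-n20-w1` (gen 4) on node N20 = NE7b; key item K3⁷
`SpineGivenEndpointR13SepCoPH` = stmt-QuantumFields-20544 (`--kind proof --supports 20544 --as helper`); COUNT-NEUTRAL.  Bus: CLAIM-7 ∕ INTENT-11 (INBOX l.28867).

WHY.  The registered K3⁷ skeleton v5 (plan g82, 941dddb108cbaacf; stub-2 texts = v4's) asks in `stub_expansion13H`, per guarded pinned reading carrying the rates, for SOME cut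
reading `jc : CutReading`, SOME shell split `sh` and SOME spine reading `cr` with `PinnedAtLive jc sh cr` (on the live-selector line `cr = crOfRecord₁₃V (jc …) sh`) and the four
faces N20 `KeyedRelWeight cr`, N21 `KeyedShellWeight cr`, N27x `KeyedExtraction cr`, N19′ `KeyedCoreEdgeHolderD4 β cr rr` (the last two under the crux's prefix
`(B) → EndpointExistence → ForSmallCouplings D`).  The N20 census located the dial `jc`: FREE at `0` (dag-n20-w2 p590852 ∕ this seat's g2 `…ZeroDialFacesAtRecord13CoPHV`),
over-cutting EXCLUDED (dag-n20-w2 p597397), eventually `0` under first-level saturation (this seat's POLICY WALL p597932; toy inhabitant p605682), and — dag-n19-w1 g2's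
`…N19CutTransferAtSpineReading` — REDUNDANT for node U5's hybrid binder list `HybridNE7` per tuple: every witness at cut `jcut` FOLDS to the zero cut with the folded split `sh♯` («the
whole class weight on the `jcut`-bad keys, `sh` off them»).  That §2 transfer consumes the budget `W + Wsh < 1` (a field of `HybridNE7`), which v5's SEPARATE faces do not carry
(dag-n27-a: the budget is redundant in the tail).  THIS FILE is the budget-free closure AT THE v5 STUB-BODY LEVEL: from ANY witness `(jc, sh, cr)` of the five conjuncts, the pair
`(sh♯, cr♯)` — `sh♯` folding `sh` at every tuple, `cr♯ := crOfRecord₁₃V 0 sh♯` ON the live line and `cr` OFF it — witnesses the five conjuncts AT THE ZERO CUT: N20 is FREE at cut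
`0` (`relWeightBound_crOfRecord₁₃VAt_cutZero`, any split); N21 by dag-n19-w1's `shellWeightBound_carriers₁₃_foldCut` + dag-n20-d's transfer `shellWeightBound_crOfRecord₁₃VAt`
(shell weight `W + Wsh` re-canonicalised; NO budget); N27x does not read `Bad ∕ sh ∕ W` (same proposition); N19′ by `core_carriers₁₃_foldCut` (SAME `δ`) pushed through
`ForSmallCouplings.mono`; off the live line nothing is pinned and `cr` is kept.  Hence (★★ `stubTwoBody_iff_zeroCut`) the body with `∃ jc` and the body with the zero cut reading
are EQUIVALENT — a kernel-certified, located input for a v6 («drop `∃ jc`»), decided by nobody here.  The shapes are SPELLED OUT (the skeleton's `def`s live in the plan's file, not in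
the tree) and stated GENERICALLY: any `N`, any guard `G F θ` (v5: `θ.ZhUnity F 2 ∧ θ.SlotsNondegenerate₁₃ F 2`), any live predicate `Live F θ` (v5: `LiveSel`), any rates premise
`Prem F θ hP g₀ os` (v5: `PHolderD4 β (datumOfRecord₁₃CoPH F 2 θ hP) (rrOfRecord 𝔯 ksel F θ hP g₀ os)`) — the proof never reads them.
* §1 PER-TUPLE, BUDGET-FREE FOLD AT THE READING [bookkeeping]: ★ `shellWeightBound_crOfRecord₁₃VAt_cutZero_of_faces` (N20 + N21 AT the reading with cut `jcut` and split `sh` — the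
  reading's own fields as witnesses — ⇒ N21 AT the reading with cut `0` and any folded split `sh'`) · ★ `coreEdge_crOfRecord₁₃VAt_cutZero_of_coreEdge` (`∃ δ, Core … δ ∧ Summable δ`
  AT cut `jcut` ⇒ AT cut `0` with `sh'`, same `δ`) · `extraction_crOfRecord₁₃VAt_iff` (the extraction body at `(jcut, sh)` and at `(0, sh')` is ONE proposition).
* §2 THE STUB-2 BODY [bookkeeping]: ★★ `exists_zeroCut_of_exists` (any witness `(jc, sh, cr)` ⇒ a zero-cut witness `(sh♯, cr♯)`) · `exists_of_exists_zeroCut` (the zero cut reading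
  is a cut reading) · ★★ `stubTwoBody_iff_zeroCut`.

HONEST FRAMING.  [bookkeeping] over the tree's SHAPES and dag-n20-d's reading BY NAME (dag-n19-w1's fold lemmas, dag-n20-d's transfers, dag-n20-w2's cut-zero face,
`ForSmallCouplings.mono`); an EQUIVALENCE OF TWO HYPOTHESIS SHAPES — neither body is inhabited here, no witness is constructed from Bałaban's objects (K3⁷ stub 2 OPEN; K0⁷ open);
proves NO estimate; nothing of Bałaban's asserted.  NE7 ∕ NE7b ∕ NE7c NOT PRINTED for `d = 4`, NOT proved; N19 ∕ N20 ∕ N21 ∕ N27 NOT discharged; K3⁷ NOT closed; counts unmoved (typed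
28∕28 · discharged 5∕27); no count claim.  One finite `𝕋⁴_{L^K}` programme at fixed `ε = L^{−K}`, Bałaban AS PRINTED; the YM mass gap (Clay) is NOT proved by any of this — R4 closes
the conditional finite-𝕋⁴ rung `BalabanLadder.UV` only; NOT ℝ⁴, NOT OS.  No `def`, no `instance`, no `notation`, no `sorry`.  Sources (bookkeeping): [Balaban1988Convergent] (2.18)
p.257; [Balaban1989LargeFieldII] (1.80) p.384; [Balaban1987RG1] Thm 2 p.259 (the tuned prefix); [King1986] (3.10)–(3.13) pp.656–657.
-/

set_option autoImplicit false

noncomputable section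

namespace Summit.QuantumFields.YangMills.BalabanUVNodes.N20CutDialElimination

open Literature.MathematicalPhysics.QuantumFieldTheory.Balaban1983to89
open Literature.MathematicalPhysics.QuantumFieldTheory.Balaban1983to89.T4Continuum
open Literature.MathematicalPhysics.QuantumFieldTheory.Balaban1983to89.Node00
open T4WeightBudget (RelWeightBound)
open T4IndicatorShell (ShellWeightBound)
open T4ContinuumYM4Torus (ForSmallCouplings)
open Summit.QuantumFields.BalabanUV.T4Continuum.Spine
open YMDAG.UVSplit hiding SU
open Summit.QuantumFields.YangMills.BalabanUVNodes.N19CutTransfer (shellWeightBound_carriers₁₃_foldCut core_carriers₁₃_foldCut)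
open Summit.QuantumFields.YangMills.BalabanUVNodes.N20ZeroDialFacesAtRecord13CoPHV (relWeightBound_crOfRecord₁₃VAt_cutZero)

variable {F : T4Family} {N : ℕ} [NeZero N]

/-! ## §1  Per tuple: the budget-free fold AT the reading of record -/

section PerTuple

variable (K₀ : ℕ) (jcut : ℕ → ℕ) (sh sh' : ShellSplit₁₃CoPH N K₀) (θ : Stage13HParams F N) (hP : θ.Provisos₁₃CoPH F N) (g₀ : ℕ → ℝ) (os : List (ULoop F))

/-- ★ **N20 + N21 AT THE READING WITH CUT `jcut` ⇒ N21 AT THE READING WITH CUT `0` AND THE FOLDED SPLIT — NO BUDGET** [bookkeeping]: the reading's own fields `W`, `Wsh` are witnesses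
at the carriers (definitionally), dag-n19-w1's `shellWeightBound_carriers₁₃_foldCut` folds them to a shell witness `W + Wsh` for `sh'`, and dag-n20-d's `shellWeightBound_crOfRecord₁₃VAt`
re-canonicalises AT the reading `crOfRecord₁₃VAt K₀ (fun _ ↦ 0) sh'`. -/
theorem shellWeightBound_crOfRecord₁₃VAt_cutZero_of_faces
    (hfold₁ : letI : DecidableEq (Σ K, SiteSeqKey F (K₀ + K)) := Classical.decEq _
      ∀ (K : ℕ) (t : ℝ) (x : Σ K, SiteSeqKey F (K₀ + K)),
        (sh' F θ hP g₀ os).1 K t x = if x ∈ badClass₁₃ θ K₀ g₀ jcut K t then weightA₁₃ θ hP K₀ g₀ os K t x else (sh F θ hP g₀ os).1 K t x)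
    (hfold₂ : letI : DecidableEq (Σ K, SiteSeqKey F (K₀ + K)) := Classical.decEq _
      ∀ (K : ℕ) (t : ℝ) (x : Σ K, SiteSeqKey F (K₀ + K)),
        (sh' F θ hP g₀ os).2 K t x = if x ∈ badClass₁₃ θ K₀ g₀ jcut K t then weightB₁₃ θ hP K₀ g₀ os K t x else (sh F θ hP g₀ os).2 K t x)
    (h20 : RelWeightBound (crOfRecord₁₃VAt K₀ jcut sh F θ hP g₀ os).l₀ (crOfRecord₁₃VAt K₀ jcut sh F θ hP g₀ os).T (crOfRecord₁₃VAt K₀ jcut sh F θ hP g₀ os).A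
      (crOfRecord₁₃VAt K₀ jcut sh F θ hP g₀ os).B (crOfRecord₁₃VAt K₀ jcut sh F θ hP g₀ os).Bad (crOfRecord₁₃VAt K₀ jcut sh F θ hP g₀ os).W)
    (h21 : ShellWeightBound (crOfRecord₁₃VAt K₀ jcut sh F θ hP g₀ os).l₀ (crOfRecord₁₃VAt K₀ jcut sh F θ hP g₀ os).T (crOfRecord₁₃VAt K₀ jcut sh F θ hP g₀ os).A
      (crOfRecord₁₃VAt K₀ jcut sh F θ hP g₀ os).B (crOfRecord₁₃VAt K₀ jcut sh F θ hP g₀ os).shA (crOfRecord₁₃VAt K₀ jcut sh F θ hP g₀ os).shB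
      (crOfRecord₁₃VAt K₀ jcut sh F θ hP g₀ os).Wsh) :
    ShellWeightBound (crOfRecord₁₃VAt K₀ (fun _ => 0) sh' F θ hP g₀ os).l₀ (crOfRecord₁₃VAt K₀ (fun _ => 0) sh' F θ hP g₀ os).T (crOfRecord₁₃VAt K₀ (fun _ => 0) sh' F θ hP g₀ os).A
      (crOfRecord₁₃VAt K₀ (fun _ => 0) sh' F θ hP g₀ os).B (crOfRecord₁₃VAt K₀ (fun _ => 0) sh' F θ hP g₀ os).shA (crOfRecord₁₃VAt K₀ (fun _ => 0) sh' F θ hP g₀ os).shB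
      (crOfRecord₁₃VAt K₀ (fun _ => 0) sh' F θ hP g₀ os).Wsh :=
  shellWeightBound_crOfRecord₁₃VAt K₀ (fun _ => 0) sh' θ hP g₀ os (shellWeightBound_carriers₁₃_foldCut K₀ jcut θ hP g₀ os hfold₁ hfold₂ h20 h21)

/-- ★ **N19′'s ∃δ-EDGE AT THE READING WITH CUT `jcut` ⇒ AT THE READING WITH CUT `0` AND THE FOLDED SPLIT, SAME `δ`** [bookkeeping] (dag-n19-w1's `core_carriers₁₃_foldCut`; the
reading's fields and its `dec` are the carriers' by `rfl`). -/
theorem coreEdge_crOfRecord₁₃VAt_cutZero_of_coreEdge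
    (hfold₁ : letI : DecidableEq (Σ K, SiteSeqKey F (K₀ + K)) := Classical.decEq _
      ∀ (K : ℕ) (t : ℝ) (x : Σ K, SiteSeqKey F (K₀ + K)),
        (sh' F θ hP g₀ os).1 K t x = if x ∈ badClass₁₃ θ K₀ g₀ jcut K t then weightA₁₃ θ hP K₀ g₀ os K t x else (sh F θ hP g₀ os).1 K t x)
    (hfold₂ : letI : DecidableEq (Σ K, SiteSeqKey F (K₀ + K)) := Classical.decEq _
      ∀ (K : ℕ) (t : ℝ) (x : Σ K, SiteSeqKey F (K₀ + K)),
        (sh' F θ hP g₀ os).2 K t x = if x ∈ badClass₁₃ θ K₀ g₀ jcut K t then weightB₁₃ θ hP K₀ g₀ os K t x else (sh F θ hP g₀ os).2 K t x)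
    (h : letI := (crOfRecord₁₃VAt K₀ jcut sh F θ hP g₀ os).dec
      ∃ δ : ℕ → ℝ, NE7.Core (crOfRecord₁₃VAt K₀ jcut sh F θ hP g₀ os).l₀ (crOfRecord₁₃VAt K₀ jcut sh F θ hP g₀ os).vol (crOfRecord₁₃VAt K₀ jcut sh F θ hP g₀ os).T
        (crOfRecord₁₃VAt K₀ jcut sh F θ hP g₀ os).Bad
        (fun K t τ => (crOfRecord₁₃VAt K₀ jcut sh F θ hP g₀ os).A K t τ - (crOfRecord₁₃VAt K₀ jcut sh F θ hP g₀ os).shA K t τ)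
        (fun K t τ => (crOfRecord₁₃VAt K₀ jcut sh F θ hP g₀ os).B K t τ - (crOfRecord₁₃VAt K₀ jcut sh F θ hP g₀ os).shB K t τ) δ ∧ Summable δ) :
    letI := (crOfRecord₁₃VAt K₀ (fun _ => 0) sh' F θ hP g₀ os).dec
    ∃ δ : ℕ → ℝ, NE7.Core (crOfRecord₁₃VAt K₀ (fun _ => 0) sh' F θ hP g₀ os).l₀ (crOfRecord₁₃VAt K₀ (fun _ => 0) sh' F θ hP g₀ os).vol
      (crOfRecord₁₃VAt K₀ (fun _ => 0) sh' F θ hP g₀ os).T (crOfRecord₁₃VAt K₀ (fun _ => 0) sh' F θ hP g₀ os).Bad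
      (fun K t τ => (crOfRecord₁₃VAt K₀ (fun _ => 0) sh' F θ hP g₀ os).A K t τ - (crOfRecord₁₃VAt K₀ (fun _ => 0) sh' F θ hP g₀ os).shA K t τ)
      (fun K t τ => (crOfRecord₁₃VAt K₀ (fun _ => 0) sh' F θ hP g₀ os).B K t τ - (crOfRecord₁₃VAt K₀ (fun _ => 0) sh' F θ hP g₀ os).shB K t τ) δ ∧ Summable δ := by
  obtain ⟨δ, hc, hs⟩ := h
  exact ⟨δ, core_carriers₁₃_foldCut K₀ jcut θ hP g₀ os hfold₁ hfold₂ hc, hs⟩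

/-- **THE EXTRACTION BODY DOES NOT READ THE CUT OR THE SPLIT** [bookkeeping]: at `(jcut, sh)` and at `(0, sh')` the N27x body of the reading is ONE proposition (`l₀`, `vol`, `K₀`,
`T`, `A`, `B` are the same fields by `rfl`). -/
theorem extraction_crOfRecord₁₃VAt_iff (Z : ℕ → ℝ → ℝ) :
    (0 < (crOfRecord₁₃VAt K₀ jcut sh F θ hP g₀ os).l₀ ∧ 0 < (crOfRecord₁₃VAt K₀ jcut sh F θ hP g₀ os).vol ∧
      (∀ (K : ℕ) (t : ℝ), |t| ≤ (crOfRecord₁₃VAt K₀ jcut sh F θ hP g₀ os).l₀ →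
        Z ((crOfRecord₁₃VAt K₀ jcut sh F θ hP g₀ os).K₀ + K) t = ∑ τ ∈ (crOfRecord₁₃VAt K₀ jcut sh F θ hP g₀ os).T K, (crOfRecord₁₃VAt K₀ jcut sh F θ hP g₀ os).A K t τ) ∧
      (∀ (K : ℕ) (t : ℝ), |t| ≤ (crOfRecord₁₃VAt K₀ jcut sh F θ hP g₀ os).l₀ →
        Z ((crOfRecord₁₃VAt K₀ jcut sh F θ hP g₀ os).K₀ + K + 1) t = ∑ τ ∈ (crOfRecord₁₃VAt K₀ jcut sh F θ hP g₀ os).T K, (crOfRecord₁₃VAt K₀ jcut sh F θ hP g₀ os).B K t τ)) ↔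
    (0 < (crOfRecord₁₃VAt K₀ (fun _ => 0) sh' F θ hP g₀ os).l₀ ∧ 0 < (crOfRecord₁₃VAt K₀ (fun _ => 0) sh' F θ hP g₀ os).vol ∧
      (∀ (K : ℕ) (t : ℝ), |t| ≤ (crOfRecord₁₃VAt K₀ (fun _ => 0) sh' F θ hP g₀ os).l₀ →
        Z ((crOfRecord₁₃VAt K₀ (fun _ => 0) sh' F θ hP g₀ os).K₀ + K) t =
          ∑ τ ∈ (crOfRecord₁₃VAt K₀ (fun _ => 0) sh' F θ hP g₀ os).T K, (crOfRecord₁₃VAt K₀ (fun _ => 0) sh' F θ hP g₀ os).A K t τ) ∧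
      (∀ (K : ℕ) (t : ℝ), |t| ≤ (crOfRecord₁₃VAt K₀ (fun _ => 0) sh' F θ hP g₀ os).l₀ →
        Z ((crOfRecord₁₃VAt K₀ (fun _ => 0) sh' F θ hP g₀ os).K₀ + K + 1) t =
          ∑ τ ∈ (crOfRecord₁₃VAt K₀ (fun _ => 0) sh' F θ hP g₀ os).T K, (crOfRecord₁₃VAt K₀ (fun _ => 0) sh' F θ hP g₀ os).B K t τ)) :=
  Iff.rfl

end PerTuple

/-! ## §2  The stub-2 body: any witness folds to a zero-cut witness (shapes of K3⁷ v5 spelled out, generic letters) -/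

section Body

variable (Live G : (F : T4Family) → Stage13HParams F N → Prop)
  (Prem : (F : T4Family) → (θ : Stage13HParams F N) → θ.Provisos₁₃CoPH F N → (ℕ → ℝ) → List (ULoop F) → Prop)

/-- ★★ **ANY STUB-2 WITNESS FOLDS TO A ZERO-CUT WITNESS** [bookkeeping].  Shapes (v5, spelled out; `cr F θ hP g₀ os` abbreviated `S`): `PinnedAtLive jc sh cr` = «`Live F θ → S =
crOfRecord₁₃V (jc F θ hP g₀ os) sh F θ hP g₀ os`»; `KeyedRelWeight` = «guard → admissible → ∀ g₀ os, `RelWeightBound S.l₀ S.T S.A S.B S.Bad S.W`»; `KeyedShellWeight` likewise with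
`ShellWeightBound … S.shA S.shB S.Wsh`; `KeyedExtraction` ∕ `KeyedCoreEdgeHolderD4` under «guard → admissible → (B) → EndpointExistence → `ForSmallCouplings (datumOfRecord₁₃CoPH F N θ hP)`»
with the rates premise `Prem`.  Given a witness `(jc, sh, cr)`, the folded split `sh♯` and the reading `crOfRecord₁₃V 0 sh♯` ON the live line ∕ `cr` OFF it witness the zero-cut body. -/
theorem exists_zeroCut_of_exists
    (h : ∃ (jc : (F : T4Family) → (θ : Stage13HParams F N) → θ.Provisos₁₃CoPH F N → (ℕ → ℝ) → List (ULoop F) → ℕ → ℕ)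
        (sh : ShellSplit₁₃CoPH N 0) (cr : SpineReading₁₃CoPH N),
      (∀ (F : T4Family) (θ : Stage13HParams F N) (hP : θ.Provisos₁₃CoPH F N) (g₀ : ℕ → ℝ) (os : List (ULoop F)),
          Live F θ → cr F θ hP g₀ os = crOfRecord₁₃V (jc F θ hP g₀ os) sh F θ hP g₀ os) ∧
      (∀ (F : T4Family) (θ : Stage13HParams F N) (hP : θ.Provisos₁₃CoPH F N), G F θ → θ.Admissible F N → ∀ (g₀ : ℕ → ℝ) (os : List (ULoop F)),
          RelWeightBound (cr F θ hP g₀ os).l₀ (cr F θ hP g₀ os).T (cr F θ hP g₀ os).A (cr F θ hP g₀ os).B (cr F θ hP g₀ os).Bad (cr F θ hP g₀ os).W) ∧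
      (∀ (F : T4Family) (θ : Stage13HParams F N) (hP : θ.Provisos₁₃CoPH F N), G F θ → θ.Admissible F N → ∀ (g₀ : ℕ → ℝ) (os : List (ULoop F)),
          ShellWeightBound (cr F θ hP g₀ os).l₀ (cr F θ hP g₀ os).T (cr F θ hP g₀ os).A (cr F θ hP g₀ os).B (cr F θ hP g₀ os).shA (cr F θ hP g₀ os).shB
            (cr F θ hP g₀ os).Wsh) ∧
      (∀ (F : T4Family) (θ : Stage13HParams F N) (hP : θ.Provisos₁₃CoPH F N), G F θ → θ.Admissible F N →
          B16.EndStatementBPrinted (datumOfRecord₁₃CoPH F N θ hP).C → DagBinding.EndpointExistence (datumOfRecord₁₃CoPH F N θ hP).C.toB12 →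
            ForSmallCouplings (datumOfRecord₁₃CoPH F N θ hP) fun g₀ => ∀ os : List (ULoop F),
              0 < (cr F θ hP g₀ os).l₀ ∧ 0 < (cr F θ hP g₀ os).vol ∧
              (∀ (K : ℕ) (t : ℝ), |t| ≤ (cr F θ hP g₀ os).l₀ →
                T4GenFunBounds.schemeZ ((datumOfRecord₁₃CoPH F N θ hP).scheme g₀) os ((cr F θ hP g₀ os).K₀ + K) t =
                  ∑ τ ∈ (cr F θ hP g₀ os).T K, (cr F θ hP g₀ os).A K t τ) ∧
              (∀ (K : ℕ) (t : ℝ), |t| ≤ (cr F θ hP g₀ os).l₀ →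
                T4GenFunBounds.schemeZ ((datumOfRecord₁₃CoPH F N θ hP).scheme g₀) os ((cr F θ hP g₀ os).K₀ + K + 1) t =
                  ∑ τ ∈ (cr F θ hP g₀ os).T K, (cr F θ hP g₀ os).B K t τ)) ∧
      (∀ (F : T4Family) (θ : Stage13HParams F N) (hP : θ.Provisos₁₃CoPH F N), G F θ → θ.Admissible F N →
          B16.EndStatementBPrinted (datumOfRecord₁₃CoPH F N θ hP).C → DagBinding.EndpointExistence (datumOfRecord₁₃CoPH F N θ hP).C.toB12 →
            ForSmallCouplings (datumOfRecord₁₃CoPH F N θ hP) fun g₀ => ∀ os : List (ULoop F),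
              Prem F θ hP g₀ os → letI := (cr F θ hP g₀ os).dec
                ∃ δ : ℕ → ℝ, NE7.Core (cr F θ hP g₀ os).l₀ (cr F θ hP g₀ os).vol (cr F θ hP g₀ os).T (cr F θ hP g₀ os).Bad
                  (fun K t τ => (cr F θ hP g₀ os).A K t τ - (cr F θ hP g₀ os).shA K t τ)
                  (fun K t τ => (cr F θ hP g₀ os).B K t τ - (cr F θ hP g₀ os).shB K t τ) δ ∧ Summable δ)) :
    ∃ (sh : ShellSplit₁₃CoPH N 0) (cr : SpineReading₁₃CoPH N),
      (∀ (F : T4Family) (θ : Stage13HParams F N) (hP : θ.Provisos₁₃CoPH F N) (g₀ : ℕ → ℝ) (os : List (ULoop F)),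
          Live F θ → cr F θ hP g₀ os = crOfRecord₁₃V (fun _ => 0) sh F θ hP g₀ os) ∧
      (∀ (F : T4Family) (θ : Stage13HParams F N) (hP : θ.Provisos₁₃CoPH F N), G F θ → θ.Admissible F N → ∀ (g₀ : ℕ → ℝ) (os : List (ULoop F)),
          RelWeightBound (cr F θ hP g₀ os).l₀ (cr F θ hP g₀ os).T (cr F θ hP g₀ os).A (cr F θ hP g₀ os).B (cr F θ hP g₀ os).Bad (cr F θ hP g₀ os).W) ∧
      (∀ (F : T4Family) (θ : Stage13HParams F N) (hP : θ.Provisos₁₃CoPH F N), G F θ → θ.Admissible F N → ∀ (g₀ : ℕ → ℝ) (os : List (ULoop F)),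
          ShellWeightBound (cr F θ hP g₀ os).l₀ (cr F θ hP g₀ os).T (cr F θ hP g₀ os).A (cr F θ hP g₀ os).B (cr F θ hP g₀ os).shA (cr F θ hP g₀ os).shB
            (cr F θ hP g₀ os).Wsh) ∧
      (∀ (F : T4Family) (θ : Stage13HParams F N) (hP : θ.Provisos₁₃CoPH F N), G F θ → θ.Admissible F N →
          B16.EndStatementBPrinted (datumOfRecord₁₃CoPH F N θ hP).C → DagBinding.EndpointExistence (datumOfRecord₁₃CoPH F N θ hP).C.toB12 →
            ForSmallCouplings (datumOfRecord₁₃CoPH F N θ hP) fun g₀ => ∀ os : List (ULoop F),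
              0 < (cr F θ hP g₀ os).l₀ ∧ 0 < (cr F θ hP g₀ os).vol ∧
              (∀ (K : ℕ) (t : ℝ), |t| ≤ (cr F θ hP g₀ os).l₀ →
                T4GenFunBounds.schemeZ ((datumOfRecord₁₃CoPH F N θ hP).scheme g₀) os ((cr F θ hP g₀ os).K₀ + K) t =
                  ∑ τ ∈ (cr F θ hP g₀ os).T K, (cr F θ hP g₀ os).A K t τ) ∧
              (∀ (K : ℕ) (t : ℝ), |t| ≤ (cr F θ hP g₀ os).l₀ →
                T4GenFunBounds.schemeZ ((datumOfRecord₁₃CoPH F N θ hP).scheme g₀) os ((cr F θ hP g₀ os).K₀ + K + 1) t =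
                  ∑ τ ∈ (cr F θ hP g₀ os).T K, (cr F θ hP g₀ os).B K t τ)) ∧
      (∀ (F : T4Family) (θ : Stage13HParams F N) (hP : θ.Provisos₁₃CoPH F N), G F θ → θ.Admissible F N →
          B16.EndStatementBPrinted (datumOfRecord₁₃CoPH F N θ hP).C → DagBinding.EndpointExistence (datumOfRecord₁₃CoPH F N θ hP).C.toB12 →
            ForSmallCouplings (datumOfRecord₁₃CoPH F N θ hP) fun g₀ => ∀ os : List (ULoop F),
              Prem F θ hP g₀ os → letI := (cr F θ hP g₀ os).dec
                ∃ δ : ℕ → ℝ, NE7.Core (cr F θ hP g₀ os).l₀ (cr F θ hP g₀ os).vol (cr F θ hP g₀ os).T (cr F θ hP g₀ os).Bad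
                  (fun K t τ => (cr F θ hP g₀ os).A K t τ - (cr F θ hP g₀ os).shA K t τ)
                  (fun K t τ => (cr F θ hP g₀ os).B K t τ - (cr F θ hP g₀ os).shB K t τ) δ ∧ Summable δ) := by
  classical
  obtain ⟨jc, sh, cr, hpin, h20, h21, hx, h19⟩ := h
  -- the folded split: the whole class weight on the `jc`-bad keys, `sh` off them (dag-n19-w1's fold equations, at every tuple)
  let shS : ShellSplit₁₃CoPH N 0 := fun F θ hP g₀ os =>
    (fun K t x => if x ∈ badClass₁₃ θ 0 g₀ (jc F θ hP g₀ os) K t then weightA₁₃ θ hP 0 g₀ os K t x else (sh F θ hP g₀ os).1 K t x,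
     fun K t x => if x ∈ badClass₁₃ θ 0 g₀ (jc F θ hP g₀ os) K t then weightB₁₃ θ hP 0 g₀ os K t x else (sh F θ hP g₀ os).2 K t x)
  -- the folded reading: the zero-cut reading of record ON the live line, the given reading OFF it
  let crS : SpineReading₁₃CoPH N := fun F θ hP g₀ os => if Live F θ then crOfRecord₁₃V (fun _ => 0) shS F θ hP g₀ os else cr F θ hP g₀ os
  have hon : ∀ (F : T4Family) (θ : Stage13HParams F N) (hP : θ.Provisos₁₃CoPH F N) (g₀ : ℕ → ℝ) (os : List (ULoop F)),
      Live F θ → crS F θ hP g₀ os = crOfRecord₁₃VAt 0 (fun _ => 0) shS F θ hP g₀ os := fun F θ hP g₀ os hL => if_pos hL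
  have hoff : ∀ (F : T4Family) (θ : Stage13HParams F N) (hP : θ.Provisos₁₃CoPH F N) (g₀ : ℕ → ℝ) (os : List (ULoop F)),
      ¬ Live F θ → crS F θ hP g₀ os = cr F θ hP g₀ os := fun F θ hP g₀ os hL => if_neg hL
  have hpin' : ∀ (F : T4Family) (θ : Stage13HParams F N) (hP : θ.Provisos₁₃CoPH F N) (g₀ : ℕ → ℝ) (os : List (ULoop F)),
      Live F θ → cr F θ hP g₀ os = crOfRecord₁₃VAt 0 (jc F θ hP g₀ os) sh F θ hP g₀ os := fun F θ hP g₀ os hL => hpin F θ hP g₀ os hL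
  have hfold₁ : ∀ (F : T4Family) (θ : Stage13HParams F N) (hP : θ.Provisos₁₃CoPH F N) (g₀ : ℕ → ℝ) (os : List (ULoop F)),
      letI : DecidableEq (Σ K, SiteSeqKey F (0 + K)) := Classical.decEq _
      ∀ (K : ℕ) (t : ℝ) (x : Σ K, SiteSeqKey F (0 + K)),
        (shS F θ hP g₀ os).1 K t x = if x ∈ badClass₁₃ θ 0 g₀ (jc F θ hP g₀ os) K t then weightA₁₃ θ hP 0 g₀ os K t x else (sh F θ hP g₀ os).1 K t x := by
    intro F θ hP g₀ os K t x
    show (if x ∈ badClass₁₃ θ 0 g₀ (jc F θ hP g₀ os) K t then weightA₁₃ θ hP 0 g₀ os K t x else (sh F θ hP g₀ os).1 K t x) = _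
    split_ifs <;> rfl
  have hfold₂ : ∀ (F : T4Family) (θ : Stage13HParams F N) (hP : θ.Provisos₁₃CoPH F N) (g₀ : ℕ → ℝ) (os : List (ULoop F)),
      letI : DecidableEq (Σ K, SiteSeqKey F (0 + K)) := Classical.decEq _
      ∀ (K : ℕ) (t : ℝ) (x : Σ K, SiteSeqKey F (0 + K)),
        (shS F θ hP g₀ os).2 K t x = if x ∈ badClass₁₃ θ 0 g₀ (jc F θ hP g₀ os) K t then weightB₁₃ θ hP 0 g₀ os K t x else (sh F θ hP g₀ os).2 K t x := by
    intro F θ hP g₀ os K t x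
    show (if x ∈ badClass₁₃ θ 0 g₀ (jc F θ hP g₀ os) K t then weightB₁₃ θ hP 0 g₀ os K t x else (sh F θ hP g₀ os).2 K t x) = _
    split_ifs <;> rfl
  refine ⟨shS, crS, fun F θ hP g₀ os hL => hon F θ hP g₀ os hL, ?_, ?_, ?_, ?_⟩
  · -- N20: free at the zero cut ON the live line; the given face OFF it
    intro F θ hP hG hθ g₀ os
    by_cases hL : Live F θ
    · rw [hon F θ hP g₀ os hL]
      exact relWeightBound_crOfRecord₁₃VAt_cutZero 0 θ hP g₀ os shS
    · rw [hoff F θ hP g₀ os hL]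
      exact h20 F θ hP hG hθ g₀ os
  · -- N21: the budget-free fold of §1 ON the live line
    intro F θ hP hG hθ g₀ os
    by_cases hL : Live F θ
    · rw [hon F θ hP g₀ os hL]
      have h20' := h20 F θ hP hG hθ g₀ os
      have h21' := h21 F θ hP hG hθ g₀ os
      rw [hpin' F θ hP g₀ os hL] at h20' h21'
      exact shellWeightBound_crOfRecord₁₃VAt_cutZero_of_faces 0 (jc F θ hP g₀ os) sh shS θ hP g₀ os (hfold₁ F θ hP g₀ os) (hfold₂ F θ hP g₀ os) h20' h21'
    · rw [hoff F θ hP g₀ os hL]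
      exact h21 F θ hP hG hθ g₀ os
  · -- N27x: the extraction body does not read the cut or the split
    intro F θ hP hG hθ hB hE
    by_cases hL : Live F θ
    · refine ForSmallCouplings.mono (fun g₀ hg os => ?_) (hx F θ hP hG hθ hB hE)
      have hg' := hg os
      rw [hpin' F θ hP g₀ os hL] at hg'
      rw [hon F θ hP g₀ os hL]
      exact (extraction_crOfRecord₁₃VAt_iff 0 (jc F θ hP g₀ os) sh shS θ hP g₀ os _).1 hg'
    · refine ForSmallCouplings.mono (fun g₀ hg os => ?_) (hx F θ hP hG hθ hB hE)
      rw [hoff F θ hP g₀ os hL]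
      exact hg os
  · -- N19′: the same `δ` after the fold, under the prefix
    intro F θ hP hG hθ hB hE
    by_cases hL : Live F θ
    · refine ForSmallCouplings.mono (fun g₀ hg os hprem => ?_) (h19 F θ hP hG hθ hB hE)
      have hg' := hg os hprem
      rw [hpin' F θ hP g₀ os hL] at hg'
      rw [hon F θ hP g₀ os hL]
      exact coreEdge_crOfRecord₁₃VAt_cutZero_of_coreEdge 0 (jc F θ hP g₀ os) sh shS θ hP g₀ os (hfold₁ F θ hP g₀ os) (hfold₂ F θ hP g₀ os) hg'
    · refine ForSmallCouplings.mono (fun g₀ hg os hprem => ?_) (h19 F θ hP hG hθ hB hE)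
      rw [hoff F θ hP g₀ os hL]
      exact hg os hprem


/-- **THE ZERO CUT READING IS A CUT READING** (the trivial direction). [bookkeeping] -/
theorem exists_of_exists_zeroCut
    (h : ∃ (sh : ShellSplit₁₃CoPH N 0) (cr : SpineReading₁₃CoPH N),
      (∀ (F : T4Family) (θ : Stage13HParams F N) (hP : θ.Provisos₁₃CoPH F N) (g₀ : ℕ → ℝ) (os : List (ULoop F)),
          Live F θ → cr F θ hP g₀ os = crOfRecord₁₃V (fun _ => 0) sh F θ hP g₀ os) ∧
      (∀ (F : T4Family) (θ : Stage13HParams F N) (hP : θ.Provisos₁₃CoPH F N), G F θ → θ.Admissible F N → ∀ (g₀ : ℕ → ℝ) (os : List (ULoop F)),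
          RelWeightBound (cr F θ hP g₀ os).l₀ (cr F θ hP g₀ os).T (cr F θ hP g₀ os).A (cr F θ hP g₀ os).B (cr F θ hP g₀ os).Bad (cr F θ hP g₀ os).W) ∧
      (∀ (F : T4Family) (θ : Stage13HParams F N) (hP : θ.Provisos₁₃CoPH F N), G F θ → θ.Admissible F N → ∀ (g₀ : ℕ → ℝ) (os : List (ULoop F)),
          ShellWeightBound (cr F θ hP g₀ os).l₀ (cr F θ hP g₀ os).T (cr F θ hP g₀ os).A (cr F θ hP g₀ os).B (cr F θ hP g₀ os).shA (cr F θ hP g₀ os).shB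
            (cr F θ hP g₀ os).Wsh) ∧
      (∀ (F : T4Family) (θ : Stage13HParams F N) (hP : θ.Provisos₁₃CoPH F N), G F θ → θ.Admissible F N →
          B16.EndStatementBPrinted (datumOfRecord₁₃CoPH F N θ hP).C → DagBinding.EndpointExistence (datumOfRecord₁₃CoPH F N θ hP).C.toB12 →
            ForSmallCouplings (datumOfRecord₁₃CoPH F N θ hP) fun g₀ => ∀ os : List (ULoop F),
              0 < (cr F θ hP g₀ os).l₀ ∧ 0 < (cr F θ hP g₀ os).vol ∧
              (∀ (K : ℕ) (t : ℝ), |t| ≤ (cr F θ hP g₀ os).l₀ →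
                T4GenFunBounds.schemeZ ((datumOfRecord₁₃CoPH F N θ hP).scheme g₀) os ((cr F θ hP g₀ os).K₀ + K) t =
                  ∑ τ ∈ (cr F θ hP g₀ os).T K, (cr F θ hP g₀ os).A K t τ) ∧
              (∀ (K : ℕ) (t : ℝ), |t| ≤ (cr F θ hP g₀ os).l₀ →
                T4GenFunBounds.schemeZ ((datumOfRecord₁₃CoPH F N θ hP).scheme g₀) os ((cr F θ hP g₀ os).K₀ + K + 1) t =
                  ∑ τ ∈ (cr F θ hP g₀ os).T K, (cr F θ hP g₀ os).B K t τ)) ∧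
      (∀ (F : T4Family) (θ : Stage13HParams F N) (hP : θ.Provisos₁₃CoPH F N), G F θ → θ.Admissible F N →
          B16.EndStatementBPrinted (datumOfRecord₁₃CoPH F N θ hP).C → DagBinding.EndpointExistence (datumOfRecord₁₃CoPH F N θ hP).C.toB12 →
            ForSmallCouplings (datumOfRecord₁₃CoPH F N θ hP) fun g₀ => ∀ os : List (ULoop F),
              Prem F θ hP g₀ os → letI := (cr F θ hP g₀ os).dec
                ∃ δ : ℕ → ℝ, NE7.Core (cr F θ hP g₀ os).l₀ (cr F θ hP g₀ os).vol (cr F θ hP g₀ os).T (cr F θ hP g₀ os).Bad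
                  (fun K t τ => (cr F θ hP g₀ os).A K t τ - (cr F θ hP g₀ os).shA K t τ)
                  (fun K t τ => (cr F θ hP g₀ os).B K t τ - (cr F θ hP g₀ os).shB K t τ) δ ∧ Summable δ)) :
    ∃ (jc : (F : T4Family) → (θ : Stage13HParams F N) → θ.Provisos₁₃CoPH F N → (ℕ → ℝ) → List (ULoop F) → ℕ → ℕ)
        (sh : ShellSplit₁₃CoPH N 0) (cr : SpineReading₁₃CoPH N),
      (∀ (F : T4Family) (θ : Stage13HParams F N) (hP : θ.Provisos₁₃CoPH F N) (g₀ : ℕ → ℝ) (os : List (ULoop F)),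
          Live F θ → cr F θ hP g₀ os = crOfRecord₁₃V (jc F θ hP g₀ os) sh F θ hP g₀ os) ∧
      (∀ (F : T4Family) (θ : Stage13HParams F N) (hP : θ.Provisos₁₃CoPH F N), G F θ → θ.Admissible F N → ∀ (g₀ : ℕ → ℝ) (os : List (ULoop F)),
          RelWeightBound (cr F θ hP g₀ os).l₀ (cr F θ hP g₀ os).T (cr F θ hP g₀ os).A (cr F θ hP g₀ os).B (cr F θ hP g₀ os).Bad (cr F θ hP g₀ os).W) ∧
      (∀ (F : T4Family) (θ : Stage13HParams F N) (hP : θ.Provisos₁₃CoPH F N), G F θ → θ.Admissible F N → ∀ (g₀ : ℕ → ℝ) (os : List (ULoop F)),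
          ShellWeightBound (cr F θ hP g₀ os).l₀ (cr F θ hP g₀ os).T (cr F θ hP g₀ os).A (cr F θ hP g₀ os).B (cr F θ hP g₀ os).shA (cr F θ hP g₀ os).shB
            (cr F θ hP g₀ os).Wsh) ∧
      (∀ (F : T4Family) (θ : Stage13HParams F N) (hP : θ.Provisos₁₃CoPH F N), G F θ → θ.Admissible F N →
          B16.EndStatementBPrinted (datumOfRecord₁₃CoPH F N θ hP).C → DagBinding.EndpointExistence (datumOfRecord₁₃CoPH F N θ hP).C.toB12 →
            ForSmallCouplings (datumOfRecord₁₃CoPH F N θ hP) fun g₀ => ∀ os : List (ULoop F),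
              0 < (cr F θ hP g₀ os).l₀ ∧ 0 < (cr F θ hP g₀ os).vol ∧
              (∀ (K : ℕ) (t : ℝ), |t| ≤ (cr F θ hP g₀ os).l₀ →
                T4GenFunBounds.schemeZ ((datumOfRecord₁₃CoPH F N θ hP).scheme g₀) os ((cr F θ hP g₀ os).K₀ + K) t =
                  ∑ τ ∈ (cr F θ hP g₀ os).T K, (cr F θ hP g₀ os).A K t τ) ∧
              (∀ (K : ℕ) (t : ℝ), |t| ≤ (cr F θ hP g₀ os).l₀ →
                T4GenFunBounds.schemeZ ((datumOfRecord₁₃CoPH F N θ hP).scheme g₀) os ((cr F θ hP g₀ os).K₀ + K + 1) t =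
                  ∑ τ ∈ (cr F θ hP g₀ os).T K, (cr F θ hP g₀ os).B K t τ)) ∧
      (∀ (F : T4Family) (θ : Stage13HParams F N) (hP : θ.Provisos₁₃CoPH F N), G F θ → θ.Admissible F N →
          B16.EndStatementBPrinted (datumOfRecord₁₃CoPH F N θ hP).C → DagBinding.EndpointExistence (datumOfRecord₁₃CoPH F N θ hP).C.toB12 →
            ForSmallCouplings (datumOfRecord₁₃CoPH F N θ hP) fun g₀ => ∀ os : List (ULoop F),
              Prem F θ hP g₀ os → letI := (cr F θ hP g₀ os).dec
                ∃ δ : ℕ → ℝ, NE7.Core (cr F θ hP g₀ os).l₀ (cr F θ hP g₀ os).vol (cr F θ hP g₀ os).T (cr F θ hP g₀ os).Bad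
                  (fun K t τ => (cr F θ hP g₀ os).A K t τ - (cr F θ hP g₀ os).shA K t τ)
                  (fun K t τ => (cr F θ hP g₀ os).B K t τ - (cr F θ hP g₀ os).shB K t τ) δ ∧ Summable δ) := by
  obtain ⟨sh, cr, hpin, h20, h21, hx, h19⟩ := h
  exact ⟨fun _ _ _ _ _ _ => 0, sh, cr, hpin, h20, h21, hx, h19⟩

/-- ★★ **THE CUT DIAL OF STUB 2 IS ELIMINABLE** [bookkeeping]: K3⁷ v5's stub-2 body (shapes spelled out, generic letters) is EQUIVALENT to its zero-cut specialisation. -/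
theorem stubTwoBody_iff_zeroCut :
    (∃ (jc : (F : T4Family) → (θ : Stage13HParams F N) → θ.Provisos₁₃CoPH F N → (ℕ → ℝ) → List (ULoop F) → ℕ → ℕ)
        (sh : ShellSplit₁₃CoPH N 0) (cr : SpineReading₁₃CoPH N),
      (∀ (F : T4Family) (θ : Stage13HParams F N) (hP : θ.Provisos₁₃CoPH F N) (g₀ : ℕ → ℝ) (os : List (ULoop F)),
          Live F θ → cr F θ hP g₀ os = crOfRecord₁₃V (jc F θ hP g₀ os) sh F θ hP g₀ os) ∧
      (∀ (F : T4Family) (θ : Stage13HParams F N) (hP : θ.Provisos₁₃CoPH F N), G F θ → θ.Admissible F N → ∀ (g₀ : ℕ → ℝ) (os : List (ULoop F)),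
          RelWeightBound (cr F θ hP g₀ os).l₀ (cr F θ hP g₀ os).T (cr F θ hP g₀ os).A (cr F θ hP g₀ os).B (cr F θ hP g₀ os).Bad (cr F θ hP g₀ os).W) ∧
      (∀ (F : T4Family) (θ : Stage13HParams F N) (hP : θ.Provisos₁₃CoPH F N), G F θ → θ.Admissible F N → ∀ (g₀ : ℕ → ℝ) (os : List (ULoop F)),
          ShellWeightBound (cr F θ hP g₀ os).l₀ (cr F θ hP g₀ os).T (cr F θ hP g₀ os).A (cr F θ hP g₀ os).B (cr F θ hP g₀ os).shA (cr F θ hP g₀ os).shB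
            (cr F θ hP g₀ os).Wsh) ∧
      (∀ (F : T4Family) (θ : Stage13HParams F N) (hP : θ.Provisos₁₃CoPH F N), G F θ → θ.Admissible F N →
          B16.EndStatementBPrinted (datumOfRecord₁₃CoPH F N θ hP).C → DagBinding.EndpointExistence (datumOfRecord₁₃CoPH F N θ hP).C.toB12 →
            ForSmallCouplings (datumOfRecord₁₃CoPH F N θ hP) fun g₀ => ∀ os : List (ULoop F),
              0 < (cr F θ hP g₀ os).l₀ ∧ 0 < (cr F θ hP g₀ os).vol ∧
              (∀ (K : ℕ) (t : ℝ), |t| ≤ (cr F θ hP g₀ os).l₀ →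
                T4GenFunBounds.schemeZ ((datumOfRecord₁₃CoPH F N θ hP).scheme g₀) os ((cr F θ hP g₀ os).K₀ + K) t =
                  ∑ τ ∈ (cr F θ hP g₀ os).T K, (cr F θ hP g₀ os).A K t τ) ∧
              (∀ (K : ℕ) (t : ℝ), |t| ≤ (cr F θ hP g₀ os).l₀ →
                T4GenFunBounds.schemeZ ((datumOfRecord₁₃CoPH F N θ hP).scheme g₀) os ((cr F θ hP g₀ os).K₀ + K + 1) t =
                  ∑ τ ∈ (cr F θ hP g₀ os).T K, (cr F θ hP g₀ os).B K t τ)) ∧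
      (∀ (F : T4Family) (θ : Stage13HParams F N) (hP : θ.Provisos₁₃CoPH F N), G F θ → θ.Admissible F N →
          B16.EndStatementBPrinted (datumOfRecord₁₃CoPH F N θ hP).C → DagBinding.EndpointExistence (datumOfRecord₁₃CoPH F N θ hP).C.toB12 →
            ForSmallCouplings (datumOfRecord₁₃CoPH F N θ hP) fun g₀ => ∀ os : List (ULoop F),
              Prem F θ hP g₀ os → letI := (cr F θ hP g₀ os).dec
                ∃ δ : ℕ → ℝ, NE7.Core (cr F θ hP g₀ os).l₀ (cr F θ hP g₀ os).vol (cr F θ hP g₀ os).T (cr F θ hP g₀ os).Bad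
                  (fun K t τ => (cr F θ hP g₀ os).A K t τ - (cr F θ hP g₀ os).shA K t τ)
                  (fun K t τ => (cr F θ hP g₀ os).B K t τ - (cr F θ hP g₀ os).shB K t τ) δ ∧ Summable δ)) ↔
    ∃ (sh : ShellSplit₁₃CoPH N 0) (cr : SpineReading₁₃CoPH N),
      (∀ (F : T4Family) (θ : Stage13HParams F N) (hP : θ.Provisos₁₃CoPH F N) (g₀ : ℕ → ℝ) (os : List (ULoop F)),
          Live F θ → cr F θ hP g₀ os = crOfRecord₁₃V (fun _ => 0) sh F θ hP g₀ os) ∧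
      (∀ (F : T4Family) (θ : Stage13HParams F N) (hP : θ.Provisos₁₃CoPH F N), G F θ → θ.Admissible F N → ∀ (g₀ : ℕ → ℝ) (os : List (ULoop F)),
          RelWeightBound (cr F θ hP g₀ os).l₀ (cr F θ hP g₀ os).T (cr F θ hP g₀ os).A (cr F θ hP g₀ os).B (cr F θ hP g₀ os).Bad (cr F θ hP g₀ os).W) ∧
      (∀ (F : T4Family) (θ : Stage13HParams F N) (hP : θ.Provisos₁₃CoPH F N), G F θ → θ.Admissible F N → ∀ (g₀ : ℕ → ℝ) (os : List (ULoop F)),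
          ShellWeightBound (cr F θ hP g₀ os).l₀ (cr F θ hP g₀ os).T (cr F θ hP g₀ os).A (cr F θ hP g₀ os).B (cr F θ hP g₀ os).shA (cr F θ hP g₀ os).shB
            (cr F θ hP g₀ os).Wsh) ∧
      (∀ (F : T4Family) (θ : Stage13HParams F N) (hP : θ.Provisos₁₃CoPH F N), G F θ → θ.Admissible F N →
          B16.EndStatementBPrinted (datumOfRecord₁₃CoPH F N θ hP).C → DagBinding.EndpointExistence (datumOfRecord₁₃CoPH F N θ hP).C.toB12 →
            ForSmallCouplings (datumOfRecord₁₃CoPH F N θ hP) fun g₀ => ∀ os : List (ULoop F),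
              0 < (cr F θ hP g₀ os).l₀ ∧ 0 < (cr F θ hP g₀ os).vol ∧
              (∀ (K : ℕ) (t : ℝ), |t| ≤ (cr F θ hP g₀ os).l₀ →
                T4GenFunBounds.schemeZ ((datumOfRecord₁₃CoPH F N θ hP).scheme g₀) os ((cr F θ hP g₀ os).K₀ + K) t =
                  ∑ τ ∈ (cr F θ hP g₀ os).T K, (cr F θ hP g₀ os).A K t τ) ∧
              (∀ (K : ℕ) (t : ℝ), |t| ≤ (cr F θ hP g₀ os).l₀ →
                T4GenFunBounds.schemeZ ((datumOfRecord₁₃CoPH F N θ hP).scheme g₀) os ((cr F θ hP g₀ os).K₀ + K + 1) t =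
                  ∑ τ ∈ (cr F θ hP g₀ os).T K, (cr F θ hP g₀ os).B K t τ)) ∧
      (∀ (F : T4Family) (θ : Stage13HParams F N) (hP : θ.Provisos₁₃CoPH F N), G F θ → θ.Admissible F N →
          B16.EndStatementBPrinted (datumOfRecord₁₃CoPH F N θ hP).C → DagBinding.EndpointExistence (datumOfRecord₁₃CoPH F N θ hP).C.toB12 →
            ForSmallCouplings (datumOfRecord₁₃CoPH F N θ hP) fun g₀ => ∀ os : List (ULoop F),
              Prem F θ hP g₀ os → letI := (cr F θ hP g₀ os).dec
                ∃ δ : ℕ → ℝ, NE7.Core (cr F θ hP g₀ os).l₀ (cr F θ hP g₀ os).vol (cr F θ hP g₀ os).T (cr F θ hP g₀ os).Bad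
                  (fun K t τ => (cr F θ hP g₀ os).A K t τ - (cr F θ hP g₀ os).shA K t τ)
                  (fun K t τ => (cr F θ hP g₀ os).B K t τ - (cr F θ hP g₀ os).shB K t τ) δ ∧ Summable δ) :=
  ⟨exists_zeroCut_of_exists Live G Prem, exists_of_exists_zeroCut Live G Prem⟩

end Body

end Summit.QuantumFields.YangMills.BalabanUVNodes.N20CutDialElimination

end
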